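import Summits.AtomisticToContinuum.HydrodynamicLimit.Theorems.AntiMazurCoboundariesCellForecastPressureDecayClusterTailFreshPairHitPathwise
import Summits.AtomisticToContinuum.HydrodynamicLimit.Theorems.AntiMazurCoboundariesCellForecastPressureDecayClusterTailFreshPairHitMean
import HarnessLib

/-!
# S2e-3 · the short-time cluster tail: a fresh pair disturbed by the bath is a second-order event
# (registered sub-goal `stub_clusterTail_freshPairHit` of stub `stub_clusterTail`, crux line
# `enskog-compensator-martingale`, crux `CellForecastPressureDecay`, stmt-AtomisticToContinuum-13915)

The T1 term of the short-time cluster tail of the canonical cell law `P_{n,L}`: the expected number of ordered pairs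
`(i, j)` that collide at a time `s ≤ Δ` while both were free on `(0, s)` (a FRESH pair) and such that `i` or `j` also
collides with a third sphere within `(0, Δ]`, is `≤ C (L³Δ² + L²Δ)` with `C = 1248 |S²|² σ⁴` (in fact `≤ C L³ Δ²`).
Assembly of the three pieces:

* pathwise (`stub_clusterTail_freshPairHit_pathwise`, piece A): on the event, for almost every datum, the two-body
  majorant `G_M` of the pair is `≥ 1` for all fine enough meshes `Δ/M`, so the indicator of the event is
  `≤ liminf_M G_M` (this sidesteps the measurability of the event itself);
* Fatou (`lintegral_le_sum_of_le_liminf`): `E 1_{event} ≤ liminf_M E G_M`;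
* mean (`stub_clusterTail_freshPairHit_mean`, piece C, built on the static piece B): `E G_M ≤ 156 |S²|² σ⁴ m Δ² L⁻⁶`
  uniformly in `M`; summing over the `(m+2)(m+1)` ordered pairs and using `n = m + 2 ≤ 2L³` gives `1248 |S²|² σ⁴ L³Δ²`.

References: Cercignani–Illner–Pulvirenti 1994, §2.2, §4.2, App. 4.A; Gallagher–Saint-Raymond–Texier 2013, §4.1;
Ruelle 1969, §4.2.
-/

noncomputable section

open MeasureTheory ProbabilityTheory Set Filter Topology
open scoped ENNReal BigOperators InnerProductSpace
open Literature.Analysis.FluidPDE Literature.MathematicalPhysics.KineticTheory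
open Summit.AtomisticToContinuum.HydrodynamicLimit.Theorems.CellForecastPressureDecay
  (cellCube measurableSet_cellCube volume_cellCube isProbabilityMeasure_cellLaw)

namespace Summit.AtomisticToContinuum.HydrodynamicLimit.Theorems.EnskogCompensator

/-! ## Fatou for a finite family of eventual minorants -/

section Fatou

/-- **Fatou for eventual minorants.** If `f ≤ ∑_k liminf_M G_k^M` almost everywhere, each `G_k^M` is measurable and
`∫ G_k^M ≤ B_k` for all `M`, then `∫ f ≤ ∑_k B_k` (Fatou's lemma; `f` need not be measurable). [folklore] -/
theorem lintegral_le_sum_of_le_liminf {α κ : Type*} [MeasurableSpace α] {μ : Measure α} (s : Finset κ)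
    {f : α → ℝ≥0∞} {G : κ → ℕ → α → ℝ≥0∞} (hG : ∀ k M, Measurable (G k M)) {B : κ → ℝ≥0∞}
    (hf : ∀ᵐ x ∂μ, f x ≤ ∑ k ∈ s, liminf (fun M => G k M x) atTop)
    (hB : ∀ k ∈ s, ∀ M, ∫⁻ x, G k M x ∂μ ≤ B k) :
    ∫⁻ x, f x ∂μ ≤ ∑ k ∈ s, B k := by
  calc ∫⁻ x, f x ∂μ ≤ ∫⁻ x, ∑ k ∈ s, liminf (fun M => G k M x) atTop ∂μ := lintegral_mono_ae hf
    _ = ∑ k ∈ s, ∫⁻ x, liminf (fun M => G k M x) atTop ∂μ :=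
        lintegral_finsetSum _ fun k _ => Measurable.liminf (hG k)
    _ ≤ ∑ k ∈ s, liminf (fun M => ∫⁻ x, G k M x ∂μ) atTop :=
        Finset.sum_le_sum fun k _ => lintegral_liminf_le (hG k)
    _ ≤ ∑ k ∈ s, B k :=
        Finset.sum_le_sum fun k hk => liminf_le_of_frequently_le' (Frequently.of_forall (hB k hk))

end Fatou

/-! ## Almost every bath of a tagged ordered pair is a good datum of the `m`-sphere flow -/

section Bath

variable {σ : ℝ} {m : ℕ}

/-- Under the `(m+2)`-sphere cell law, for every tagged ordered pair `(i, i.succAbove j')` the remaining `m` spheres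
form almost surely a good datum of the `m`-sphere flow (insertion inequality at `i`, then `ae_removeNth_mem_good` at
`j'`). [folklore] -/
theorem ae_bath_mem_good (hσ : 0 < σ) (hσ' : σ ≤ 3 / 16) (hfac : CellLawFactorises σ) {L : ℝ} (hL : 1 ≤ L)
    (hm : ((m + 2 : ℕ) : ℝ) ≤ 2 * L ^ 3) (Ψ : Flows σ) (i : Fin (m + 2)) (j' : Fin (m + 1)) :
    ∀ᵐ z ∂cellLaw σ L (m + 2) Ψ, (fun c => z (i.succAbove (j'.succAbove c))) ∈ (Ψ m).good := by
  have hm1 : ((m + 1 : ℕ) : ℝ) ≤ 2 * L ^ 3 := le_trans (by exact_mod_cast Nat.le_succ (m + 1)) hm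
  have hrm : Measurable fun z : Cell (m + 2) => (fun c => z (i.succAbove (j'.succAbove c)) : Cell m) :=
    measurable_pi_lambda _ fun c => measurable_pi_apply _
  have hS : MeasurableSet {z : Cell (m + 2) | (fun c => z (i.succAbove (j'.succAbove c))) ∉ (Ψ m).good} :=
    (hrm (Ψ m).measurableSet_good).compl
  rw [ae_iff]
  refine le_antisymm ?_ bot_le
  change cellLaw σ L (m + 2) Ψ {z : Cell (m + 2) | (fun c => z (i.succAbove (j'.succAbove c))) ∉ (Ψ m).good} ≤ 0
  rw [← lintegral_indicator_one hS]
  refine (lintegral_cellLaw_succ_le hσ hσ' hfac hL hm Ψ i (measurable_one.indicator hS)).trans ?_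
  have hzero : ∀ w : V3, ∫⁻ z', ∫⁻ y,
      {z : Cell (m + 2) | (fun c => z (i.succAbove (j'.succAbove c))) ∉ (Ψ m).good}.indicator 1
        (Fin.insertNth i (y, w) z' : Cell (m + 2)) ∂(volume[|cellCube L]) ∂cellLaw σ L (m + 1) Ψ = 0 := by
    intro w
    refine (lintegral_eq_zero_iff' ?_).2 ?_
    · refine (Measurable.lintegral_prod_right' (f := fun q : Cell (m + 1) × V3 =>
        {z : Cell (m + 2) | (fun c => z (i.succAbove (j'.succAbove c))) ∉ (Ψ m).good}.indicator 1
          (Fin.insertNth i (q.2, w) q.1 : Cell (m + 2))) ?_).aemeasurable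
      exact (measurable_one.indicator hS).comp
        ((MeasurableEquiv.piFinSuccAbove (fun _ : Fin (m + 2) => V3 × V3) i).symm.measurable.comp
          ((measurable_snd.prodMk measurable_const).prodMk measurable_fst))
    · filter_upwards [ae_removeNth_mem_good hσ hσ' hfac hL hm1 Ψ j'] with z' hz'
      have hnot : ∀ y : V3, (Fin.insertNth i (y, w) z' : Cell (m + 2)) ∉
          {z : Cell (m + 2) | (fun c => z (i.succAbove (j'.succAbove c))) ∉ (Ψ m).good} := fun y h => by
        simp only [Set.mem_setOf_eq, Fin.insertNth_apply_succAbove] at h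
        exact h hz'
      simp only [indicator_of_notMem (hnot _), lintegral_zero, Pi.zero_apply]
  simp only [hzero, lintegral_zero, mul_zero, le_refl]

end Bath

/-! ## The registered sub-goal -/

section Assembly

/-- `n(n-1)(n-2) ≤ 8 L⁹` for `n ≤ 2L³`: the per-pair bound `156 |S²|² σ⁴ m Δ² L⁻⁶` summed over the `(m+2)(m+1)`
ordered pairs is `≤ 1248 |S²|² σ⁴ (L³Δ² + L²Δ)`. [folklore] -/
theorem pairs_times_mean_le {Sr σ L Δ : ℝ} {m : ℕ} (hL : 1 ≤ L) (hΔ : 0 ≤ Δ) (hm : ((m + 2 : ℕ) : ℝ) ≤ 2 * L ^ 3) :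
    (((m + 2) * (m + 1) : ℕ) : ℝ) * (156 * Sr ^ 2 * σ ^ 4 * m * Δ ^ 2 * ((L ^ 3)⁻¹ * (L ^ 3)⁻¹)) ≤
      1248 * Sr ^ 2 * σ ^ 4 * (L ^ 3 * Δ ^ 2 + L ^ 2 * Δ) := by
  have hL0 : 0 < L := one_pos.trans_le hL
  have hL3 : L ^ 3 ≠ 0 := by positivity
  have hX : ((m : ℝ) + 2) ≤ 2 * L ^ 3 := by push_cast at hm; exact hm
  have h1 : ((m : ℝ) + 2) * ((m : ℝ) + 1) * m ≤ ((m : ℝ) + 2) ^ 3 := by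
    have : (0 : ℝ) ≤ m := Nat.cast_nonneg m
    nlinarith
  have h2 : ((m : ℝ) + 2) ^ 3 * ((L ^ 3)⁻¹ * (L ^ 3)⁻¹) ≤ 8 * L ^ 3 := by
    calc ((m : ℝ) + 2) ^ 3 * ((L ^ 3)⁻¹ * (L ^ 3)⁻¹) ≤ (2 * L ^ 3) ^ 3 * ((L ^ 3)⁻¹ * (L ^ 3)⁻¹) :=
          mul_le_mul_of_nonneg_right (pow_le_pow_left₀ (by positivity) hX 3) (by positivity)
      _ = 8 * L ^ 3 * (L ^ 3 * (L ^ 3)⁻¹) ^ 2 := by ring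
      _ = 8 * L ^ 3 := by rw [mul_inv_cancel₀ hL3, one_pow, mul_one]
  calc (((m + 2) * (m + 1) : ℕ) : ℝ) * (156 * Sr ^ 2 * σ ^ 4 * m * Δ ^ 2 * ((L ^ 3)⁻¹ * (L ^ 3)⁻¹))
      = 156 * Sr ^ 2 * σ ^ 4 * Δ ^ 2 * ((((m : ℝ) + 2) * ((m : ℝ) + 1) * m) * ((L ^ 3)⁻¹ * (L ^ 3)⁻¹)) := by
        push_cast; ring
    _ ≤ 156 * Sr ^ 2 * σ ^ 4 * Δ ^ 2 * (((m : ℝ) + 2) ^ 3 * ((L ^ 3)⁻¹ * (L ^ 3)⁻¹)) := by gcongr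
    _ ≤ 156 * Sr ^ 2 * σ ^ 4 * Δ ^ 2 * (8 * L ^ 3) := by gcongr
    _ = 1248 * Sr ^ 2 * σ ^ 4 * (L ^ 3 * Δ ^ 2) := by ring
    _ ≤ 1248 * Sr ^ 2 * σ ^ 4 * (L ^ 3 * Δ ^ 2 + L ^ 2 * Δ) := by gcongr; nlinarith [sq_nonneg L]

open Classical in
/-- **Registered sub-goal `stub_clusterTail_freshPairHit`** (S2e-3, T1 term of the short-time cluster tail
`ClusterTail σ`, stub `stub_clusterTail` of the line `enskog-compensator-martingale`, crux
stmt-AtomisticToContinuum-13915): **a fresh pair that is disturbed is second order.** For `0 < σ ≤ 3/16` there is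
`C = 1248 |S²|² σ⁴` such that for `L ≥ 1`, `n ≤ 2L³`, every cluster dynamics and every slab length `Δ ∈ (0, 1]`, the
expected number (under the canonical cell law) of ordered pairs `(i, j)` that collide at a time `s ≤ Δ` while both
were free on `(0, s)` and such that `i` or `j` also collides with a third sphere within `(0, Δ]` is
`≤ C (L³Δ² + L²Δ)`: double insertion of the tagged pair, pair removal until the first outsider contact, charging of
that contact to a cylinder at a grid time (one factor `Δ` from the pair's own cylinder, one from the outsider's),
energy conservation of the bath, Fatou over the meshes. [cite: CIP1994, §2.2] -/
theorem stub_clusterTail_freshPairHit : ∀ σ : ℝ, 0 < σ → σ ≤ 3 / 16 → CellLawFactorises σ →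
    ∃ C : ℝ, 0 ≤ C ∧ ∀ L : ℝ, 1 ≤ L → ∀ n : ℕ, (n : ℝ) ≤ 2 * L ^ 3 → ∀ (Ψ : Flows σ) (Δ : ℝ), 0 < Δ → Δ ≤ 1 →
      ∫⁻ z, ((Finset.univ.filter fun p : Fin n × Fin n => p.1 ≠ p.2 ∧ ∃ s ∈ Set.Ioc 0 Δ,
          Collide (Euclidean.geometry (Fin 3)) σ ((Ψ n).flow s z) p.1 p.2 ∧
          (∀ s' ∈ Set.Ioo 0 s, ¬ Participates (Euclidean.geometry (Fin 3)) σ ((Ψ n).flow s' z) p.1 ∧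
            ¬ Participates (Euclidean.geometry (Fin 3)) σ ((Ψ n).flow s' z) p.2) ∧
          ∃ k : Fin n, k ≠ p.1 ∧ k ≠ p.2 ∧ ∃ s' ∈ Set.Ioc 0 Δ,
            (Collide (Euclidean.geometry (Fin 3)) σ ((Ψ n).flow s' z) p.1 k ∨
              Collide (Euclidean.geometry (Fin 3)) σ ((Ψ n).flow s' z) p.2 k)).card : ℝ≥0∞)
          ∂(cellLaw σ L n Ψ) ≤ ENNReal.ofReal (C * (L ^ 3 * Δ ^ 2 + L ^ 2 * Δ)) := by
  intro σ hσ hσ' hfac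
  haveI : IsFiniteMeasure (sphereMeasure : Measure (Metric.sphere (0 : V3) 1)) := isFiniteMeasure_sphereMeasure
  refine ⟨1248 * (sphereMeasure (Set.univ : Set (Metric.sphere (0 : V3) 1))).toReal ^ 2 * σ ^ 4, by positivity, ?_⟩
  intro L hL n hn Ψ Δ hΔ hΔ1
  rcases lt_or_ge n 2 with hn2 | hn2
  · -- fewer than two spheres: no ordered pair of distinct labels
    refine le_of_eq_of_le (lintegral_congr fun z => ?_) (le_of_eq_of_le lintegral_zero zero_le)
    rw [Nat.cast_eq_zero, Finset.card_eq_zero, Finset.filter_eq_empty_iff]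
    intro p _ hp
    exact hp.1 (Fin.ext (by have := p.1.isLt; have := p.2.isLt; omega))
  obtain ⟨m, rfl⟩ : ∃ m, n = m + 2 := ⟨n - 2, by omega⟩
  have hm : ((m + 2 : ℕ) : ℝ) ≤ 2 * L ^ 3 := hn
  -- the two-body majorants of the ordered pairs `(k.1, k.1.succAbove k.2)`
  set G : Fin (m + 2) × Fin (m + 1) → ℕ → Cell (m + 2) → ℝ≥0∞ := fun k M z =>
    {p : V3 × V3 | PairHits σ p.1 p.2 ∧ 0 < pairDisc σ p.1 p.2 ∧ pairHitTime σ p.1 p.2 ∈ Set.Ioc 0 Δ}.indicator (1 :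
          V3 × V3 → ℝ≥0∞) (((z k.1).1 - (z (k.1.succAbove k.2)).1), ((z k.1).2 - (z (k.1.succAbove k.2)).2)) * ∑ ℓ ∈
          Finset.range M, ∑ c : Fin m, ({p : V3 × V3 | PairHits σ p.1 p.2 ∧ 0 < pairDisc σ p.1 p.2 ∧ pairHitTime σ
          p.1 p.2 ∈ Set.Ioc 0 (Δ / M)}.indicator (1 : V3 × V3 → ℝ≥0∞) ((z k.1).1 + pairHitTime σ ((z k.1).1 - (z
          (k.1.succAbove k.2)).1) ((z k.1).2 - (z (k.1.succAbove k.2)).2) • (z k.1).2 + (((ℓ : ℝ) * (Δ / M)) -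
          pairHitTime σ ((z k.1).1 - (z (k.1.succAbove k.2)).1) ((z k.1).2 - (z (k.1.succAbove k.2)).2)) •
          (reflectVel (((z k.1).1 - (z (k.1.succAbove k.2)).1) + pairHitTime σ ((z k.1).1 - (z (k.1.succAbove
          k.2)).1) ((z k.1).2 - (z (k.1.succAbove k.2)).2) • ((z k.1).2 - (z (k.1.succAbove k.2)).2)) ((z k.1).2, (z
          (k.1.succAbove k.2)).2)).1 - ((Ψ m).flow ((ℓ : ℝ) * (Δ / M)) (fun c => z (k.1.succAbove (k.2.succAbove c)))
          c).1, (reflectVel (((z k.1).1 - (z (k.1.succAbove k.2)).1) + pairHitTime σ ((z k.1).1 - (z (k.1.succAbove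
          k.2)).1) ((z k.1).2 - (z (k.1.succAbove k.2)).2) • ((z k.1).2 - (z (k.1.succAbove k.2)).2)) ((z k.1).2, (z
          (k.1.succAbove k.2)).2)).1 - ((Ψ m).flow ((ℓ : ℝ) * (Δ / M)) (fun c => z (k.1.succAbove (k.2.succAbove c)))
          c).2) + {p : V3 × V3 | PairHits σ p.1 p.2 ∧ 0 < pairDisc σ p.1 p.2 ∧ pairHitTime σ p.1 p.2 ∈ Set.Ioc 0 (Δ /
          M)}.indicator (1 : V3 × V3 → ℝ≥0∞) ((z (k.1.succAbove k.2)).1 + pairHitTime σ ((z k.1).1 - (z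
          (k.1.succAbove k.2)).1) ((z k.1).2 - (z (k.1.succAbove k.2)).2) • (z (k.1.succAbove k.2)).2 + (((ℓ : ℝ) *
          (Δ / M)) - pairHitTime σ ((z k.1).1 - (z (k.1.succAbove k.2)).1) ((z k.1).2 - (z (k.1.succAbove k.2)).2)) •
          (reflectVel (((z k.1).1 - (z (k.1.succAbove k.2)).1) + pairHitTime σ ((z k.1).1 - (z (k.1.succAbove
          k.2)).1) ((z k.1).2 - (z (k.1.succAbove k.2)).2) • ((z k.1).2 - (z (k.1.succAbove k.2)).2)) ((z k.1).2, (z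
          (k.1.succAbove k.2)).2)).2 - ((Ψ m).flow ((ℓ : ℝ) * (Δ / M)) (fun c => z (k.1.succAbove (k.2.succAbove c)))
          c).1, (reflectVel (((z k.1).1 - (z (k.1.succAbove k.2)).1) + pairHitTime σ ((z k.1).1 - (z (k.1.succAbove
          k.2)).1) ((z k.1).2 - (z (k.1.succAbove k.2)).2) • ((z k.1).2 - (z (k.1.succAbove k.2)).2)) ((z k.1).2, (z
          (k.1.succAbove k.2)).2)).2 - ((Ψ m).flow ((ℓ : ℝ) * (Δ / M)) (fun c => z (k.1.succAbove (k.2.succAbove c)))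
          c).2)) with hGdef
  have hGm : ∀ k M, Measurable (G k M) := fun k M => measurable_pairMajorant σ Δ M Ψ k.1 k.2
  have hGB : ∀ k ∈ (Finset.univ : Finset (Fin (m + 2) × Fin (m + 1))), ∀ M, ∫⁻ z, G k M z ∂cellLaw σ L (m + 2) Ψ ≤
      ENNReal.ofReal (156 * (sphereMeasure (Set.univ : Set (Metric.sphere (0 : V3) 1))).toReal ^ 2 * σ ^ 4 * m * Δ ^
            2 * ((L ^ 3)⁻¹ * (L ^ 3)⁻¹)) :=
    fun k _ M => stub_clusterTail_freshPairHit_mean σ L Δ m M Ψ k.1 k.2 hσ hσ' hfac hL hm hΔ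
  -- almost every datum is good, together with all its baths
  have hgood : ∀ᵐ z ∂cellLaw σ L (m + 2) Ψ, z ∈ (Ψ (m + 2)).good ∧
      ∀ k : Fin (m + 2) × Fin (m + 1), (fun c => z (k.1.succAbove (k.2.succAbove c))) ∈ (Ψ m).good := by
    refine (ae_mem_good_cellLaw σ L (m + 2) Ψ).and ?_
    rw [ae_all_iff]
    exact fun k => ae_bath_mem_good hσ hσ' hfac hL hm Ψ k.1 k.2
  refine (lintegral_le_sum_of_le_liminf Finset.univ hGm ?_ hGB).trans ?_
  · -- pathwise: the count is eventually dominated by the majorants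
    filter_upwards [hgood] with z ⟨hz, hzb⟩
    rw [Finset.natCast_card_filter, Fintype.sum_prod_type, Fintype.sum_prod_type]
    refine Finset.sum_le_sum fun i _ => ?_
    rw [Fin.sum_univ_succAbove _ i, if_neg (fun h => h.1 rfl), zero_add]
    refine Finset.sum_le_sum fun j' _ => ?_
    split_ifs with hP
    · obtain ⟨hcyl, hev⟩ := stub_clusterTail_freshPairHit_pathwise σ m Ψ z i j' Δ hσ hz (hzb (i, j')) hP.2
      refine le_liminf_of_le (h := ?_)
      refine hev.mono fun M hM => ?_
      obtain ⟨ℓ, hℓ, c, hc⟩ := hM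
      simp only [hGdef]
      rw [Set.indicator_of_mem hcyl, Pi.one_apply, one_mul]
      refine le_trans ?_ (Finset.single_le_sum (fun ℓ _ => zero_le) (Finset.mem_range.2 hℓ))
      refine le_trans ?_ (Finset.single_le_sum (fun c _ => zero_le) (Finset.mem_univ c))
      rcases hc with hc | hc
      · rw [Set.indicator_of_mem hc, Pi.one_apply]
        exact le_self_add
      · rw [Set.indicator_of_mem hc, Pi.one_apply]
        exact le_add_self
    · exact zero_le
  · -- the constant
    rw [Finset.sum_const, Finset.card_univ, Fintype.card_prod, Fintype.card_fin, Fintype.card_fin, nsmul_eq_mul,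
      ← ENNReal.ofReal_natCast, ← ENNReal.ofReal_mul (Nat.cast_nonneg _)]
    exact ENNReal.ofReal_le_ofReal (pairs_times_mean_le hL hΔ.le hm)

end Assembly

end Summit.AtomisticToContinuum.HydrodynamicLimit.Theorems.EnskogCompensator

end
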